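import Summits.SmoothPoincare4.SmoothPoincare4.Theorems.CylinderEntropyImmortalAreaToFloorGramProjection
import Summits.SmoothPoincare4.SmoothPoincare4.Theorems.CylinderEntropyCylinderRungTwoFluxIdentityCharts
import Mathlib.MeasureTheory.Function.Jacobian
import HarnessLib

/-!
# Route `CylinderEntropy`, item `ImmortalAreaToFloor` (stmt-SmoothPoincare4-17197):
# the COAREA-SHADOW INEQUALITY on a chart piece

Brick (CO', analysis) of the Allard-free blueprint for the residual `ThinSeq` of the item (evidence
`ANALYSIS-prover-17197-c1.md`, §8).  For a closed embedded cross-section `ι : M → N = S⁴ × ℝ ⊂ ℝ⁶` with continuous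
unit normal `ν` tangent to `N`, and an orthonormal basis `B` of `ℝ⁶` indexed by `Fin 4 ⊕ Fin 2` whose two `inr`
vectors are HORIZONTAL, consider the coordinate map `Ψ_B : M → ℝ⁴`, `x ↦ (⟪B (inl k), ι x⟫)ₖ` (in the application:
the height and three of the four chart coordinates of the shadow).  On a measurable piece `S` of a chart domain,

* **`volume_image_coords_le_chart`** — `vol₄ (Ψ_B '' S) ≤ ∫⁻_S 2 ‖(ν x)'‖ d(ι^* μHE⁴)`,

where `(ν x)' = truncL (ν x)` is the horizontal part of the normal (so `‖(ν x)'‖² = 1 - ν₅²` is the tilt density).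
Proof: Mathlib's change-of-variables INEQUALITY `addHaar_image_le_lintegral_abs_det_fderiv` for `Ψ_B ∘ ι ∘ φ⁻¹`
on `φ S`, the Jacobi identity `det_gram_coords_inl` (`|det| = |⟪B₄, n⟫⟪B₅, ν⟫ - ⟪B₅, n⟫⟪B₄, ν⟫| · √det Gram(DΦ)`
with `n` the radial normal), the bound `|…| ≤ 2 ‖ν'‖` for horizontal unit `B₄, B₅`, and the tree's chart area
formula `setLIntegral_comap_eq_chart`.  Everything is proved; no definition, no named fact.
-/

-- the prescribed namespace `Summit.SmoothPoincare4.SmoothPoincare4.…` repeats `SmoothPoincare4`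
set_option linter.dupNamespace false

noncomputable section

open MeasureTheory Set Function Filter Module
open scoped Manifold ContDiff ENNReal Topology RealInnerProductSpace NNReal BigOperators

namespace Summit.SmoothPoincare4.SmoothPoincare4.Theorems.CylinderRungTwo.KillingFlux

open Literature.Geometry.Riemannian
open Literature.Geometry.Lorentzian Literature.Geometry.Lorentzian.PseudoRiemannianMetric
open Literature.Geometry.Riemannian.SphericalCylinderEntropy (truncL truncL_apply norm_truncL_le)
open Literature.Geometry.Manifold.CylinderSlice (axis)
open Literature.Geometry.GeometricMeasureTheory
open Summit.SmoothPoincare4.SmoothPoincare4.Theorems.CoareaShadow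

variable {M : Type} [TopologicalSpace M] [ChartedSpace (EuclideanSpace ℝ (Fin 4)) M] [IsManifold (𝓡 4) ∞ M]
  [CompactSpace M] [MeasurableSpace M] [BorelSpace M]

/-- **Coarea-shadow inequality on a chart piece.** See the module docstring: for an orthonormal basis `B` of `ℝ⁶`
indexed by `Fin 4 ⊕ Fin 2` with horizontal `B (inr 0), B (inr 1)` and a measurable piece `S` of the chart domain
at `x₀`, `vol₄ ((x ↦ (⟪B (inl k), ι x⟫)ₖ) '' S) ≤ ∫⁻_S 2‖truncL (ν x)‖ d(ι^* μHE⁴)`. [cite: Federer1969, 3.2.3] -/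
theorem volume_image_coords_le_chart {ι ν : M → (EuclideanSpace ℝ (Fin 6))}
    (hι : Manifold.IsSmoothEmbedding (𝓡 4) (𝓡 6) ∞ ι)
    (hιN : ∀ x, ∑ i : Fin 5, ι x (Fin.castSucc i) ^ 2 = 1)
    (hνc : Continuous ν) (hνn : (euclideanMetric (EuclideanSpace ℝ (Fin 6))).IsUnitNormal (𝓡 4) ι ν 1)
    (hνt : ∀ x, ∑ i : Fin 5, ν x (Fin.castSucc i) * ι x (Fin.castSucc i) = 0)
    (B : OrthonormalBasis (Fin 4 ⊕ Fin 2) ℝ (EuclideanSpace ℝ (Fin 6))) (hB : ∀ a : Fin 2, B (Sum.inr a) 5 = 0)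
    (x₀ : M) {S : Set M} (hS : MeasurableSet S) (hSx : S ⊆ (extChartAt (𝓡 4) x₀).source) :
    volume ((fun x : M => (EuclideanSpace.equiv (Fin 4) ℝ).symm fun k => ⟪B (Sum.inl k), ι x⟫) '' S) ≤
      ∫⁻ x in S, ENNReal.ofReal (2 * ‖truncL (ν x)‖)
        ∂(Measure.comap ι (μHE[4] : Measure (EuclideanSpace ℝ (Fin 6)))) := by
  classical
  set φ := extChartAt (𝓡 4) x₀ with hφ
  -- the coordinate map as a continuous linear map
  set T : EuclideanSpace ℝ (Fin 6) →L[ℝ] EuclideanSpace ℝ (Fin 4) :=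
    (EuclideanSpace.equiv (Fin 4) ℝ).symm.toContinuousLinearMap.comp
      (ContinuousLinearMap.pi fun k : Fin 4 => (innerSL ℝ (B (Sum.inl k)) : EuclideanSpace ℝ (Fin 6) →L[ℝ] ℝ))
    with hTdef
  have hT : ∀ z k, T z k = ⟪B (Sum.inl k), z⟫ := fun z k => by
    simp [hTdef]
  have hΨ : (fun x : M => (EuclideanSpace.equiv (Fin 4) ℝ).symm fun k => ⟪B (Sum.inl k), ι x⟫) =
      fun x => T (ι x) := by
    funext x; ext k; rw [hT]; rfl
  rw [hΨ]
  -- through the chart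
  have hS' : MeasurableSet (φ '' S) := measurableSet_image_extChartAt x₀ hS hSx
  have hS'U : φ '' S ⊆ φ.target := fun y ⟨z, hz, hzy⟩ => hzy ▸ φ.map_source (hSx hz)
  have himage : (fun x => T (ι x)) '' S = (fun u => T ((ι ∘ φ.symm) u)) '' (φ '' S) := by
    rw [image_image]
    refine image_congr fun z hz => ?_
    change T (ι z) = T (ι (φ.symm (φ z)))
    rw [φ.left_inv (hSx hz)]
  rw [himage]
  -- the differential of the chart representative and of `T ∘ Φ`
  set D : EuclideanSpace ℝ (Fin 4) → (EuclideanSpace ℝ (Fin 4) →L[ℝ] EuclideanSpace ℝ (Fin 6)) := fun u =>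
    ContinuousLinearMap.comp (mfderiv (𝓡 4) (𝓡 6) ι (φ.symm u))
      (mfderivWithin 𝓘(ℝ, EuclideanSpace ℝ (Fin 4)) (𝓡 4) φ.symm (Set.range (𝓡 4)) u) with hD
  have hderiv : ∀ u ∈ φ '' S,
      HasFDerivWithinAt (fun u => T ((ι ∘ φ.symm) u)) (T.comp (D u)) (φ '' S) u := fun u hu =>
    (T.hasFDerivAt.comp u (hasFDerivAt_chartRep hι x₀ (hS'U hu))).hasFDerivWithinAt
  have hjac := addHaar_image_le_lintegral_abs_det_fderiv volume hS' hderiv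
  refine hjac.trans ?_
  -- the Jacobian: `|det (T ∘ D u)| ≤ 2 ‖ν'‖ √det Gram(D u)`
  have hmeas : Measurable fun x => ENNReal.ofReal (2 * ‖truncL (ν x)‖) :=
    ENNReal.measurable_ofReal.comp
      ((continuous_const.mul (truncL.continuous.comp hνc).norm).measurable)
  rw [setLIntegral_comap_eq_chart hι x₀ hS hSx hmeas]
  refine setLIntegral_mono' hS' fun u hu => ?_
  have hut : u ∈ φ.target := hS'U hu
  set y := φ.symm u with hy
  set w : Fin 4 → EuclideanSpace ℝ (Fin 6) := fun i => D u (EuclideanSpace.basisFun (Fin 4) ℝ i) with hw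
  -- Gram determinant of `w` is positive
  have hdetpos := sqrt_det_gram_pos_of_injective (EuclideanSpace.basisFun (Fin 4) ℝ) (D u)
    (chartDeriv_injective hι x₀ hut)
  have hdet : (Matrix.of fun i j => ⟪w i, w j⟫).det ≠ 0 := by
    intro h0
    have : Real.sqrt ((Matrix.of fun i j => ⟪w i, w j⟫)).det = 0 := by rw [h0, Real.sqrt_zero]
    exact absurd this (ne_of_gt hdetpos)
  -- the matrix of `T ∘ D u` in the standard basis
  set A : Matrix (Fin 4) (Fin 4) ℝ := Matrix.of fun k i => ⟪B (Sum.inl k), w i⟫ with hA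
  have hmat : LinearMap.toMatrix (EuclideanSpace.basisFun (Fin 4) ℝ).toBasis
      (EuclideanSpace.basisFun (Fin 4) ℝ).toBasis ((T.comp (D u) : EuclideanSpace ℝ (Fin 4) →L[ℝ]
        EuclideanSpace ℝ (Fin 4)) : EuclideanSpace ℝ (Fin 4) →ₗ[ℝ] EuclideanSpace ℝ (Fin 4)) = A := by
    ext k i
    rw [LinearMap.toMatrix_apply, OrthonormalBasis.coe_toBasis_repr_apply, EuclideanSpace.basisFun_repr,
      OrthonormalBasis.coe_toBasis]
    change T (D u (EuclideanSpace.basisFun (Fin 4) ℝ i)) k = A k i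
    rw [hT, hA, Matrix.of_apply]
  have hdetT : (T.comp (D u)).det = A.det := by
    rw [ContinuousLinearMap.det, ← LinearMap.det_toMatrix (EuclideanSpace.basisFun (Fin 4) ℝ).toBasis, hmat]
  -- Jacobi: `det A ^ 2 = H ^ 2 · det Gram(w)`
  set n : EuclideanSpace ℝ (Fin 6) := ι y - (ι y) 5 • (axis : EuclideanSpace ℝ (Fin 6)) with hn
  set H : ℝ := ⟪B (Sum.inr 0), n⟫ * ⟪B (Sum.inr 1), ν y⟫ - ⟪B (Sum.inr 1), n⟫ * ⟪B (Sum.inr 0), ν y⟫ with hH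
  have hAsq : A.det ^ 2 = H ^ 2 * (Matrix.of fun i j => ⟪w i, w j⟫).det := by
    have hAtA : (Matrix.of fun i j => ∑ k : Fin 4, ⟪B (Sum.inl k), w i⟫ * ⟪B (Sum.inl k), w j⟫) =
        A.transpose * A := by
      ext i j
      simp only [Matrix.mul_apply, Matrix.transpose_apply, hA, Matrix.of_apply]
    have key := det_gram_coords_inl B w n (ν y) (fun i => inner_nrad_mfderiv hι hιN y _)
      (fun i => inner_nu_mfderiv hνn y _) (inner_nu_nrad hνt y) (norm_nrad hιN y) (norm_nu hνn y) hdet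
    rw [hAtA, Matrix.det_mul, Matrix.det_transpose] at key
    rw [sq, key]
  have habsA : |A.det| = |H| * Real.sqrt ((Matrix.of fun i j => ⟪w i, w j⟫)).det := by
    rw [← Real.sqrt_sq_eq_abs, hAsq, Real.sqrt_mul (sq_nonneg _), Real.sqrt_sq_eq_abs]
  -- `|H| ≤ 2 ‖ν'‖`
  have hBn : ∀ a : Fin 2, |⟪B (Sum.inr a), n⟫| ≤ 1 := fun a => by
    refine (abs_real_inner_le_norm _ _).trans ?_
    rw [B.orthonormal.1, one_mul, hn, norm_nrad hιN y]
  have hBν : ∀ a : Fin 2, |⟪B (Sum.inr a), ν y⟫| ≤ ‖truncL (ν y)‖ := fun a => by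
    have h1 : ⟪B (Sum.inr a), ν y⟫ = ⟪truncL (B (Sum.inr a)), truncL (ν y)⟫ := by
      rw [inner_truncL, hB a, zero_mul, sub_zero]
    rw [h1]
    refine (abs_real_inner_le_norm _ _).trans ?_
    have h2 : ‖truncL (B (Sum.inr a))‖ ≤ 1 := (norm_truncL_le _).trans (B.orthonormal.1 _).le
    exact (mul_le_mul_of_nonneg_right h2 (norm_nonneg _)).trans (one_mul _).le
  have hHle : |H| ≤ 2 * ‖truncL (ν y)‖ := by
    rw [hH]
    refine (abs_sub _ _).trans ?_
    rw [abs_mul, abs_mul, two_mul]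
    refine add_le_add ?_ ?_
    · exact (mul_le_mul (hBn 0) (hBν 1) (abs_nonneg _) zero_le_one).trans (one_mul _).le
    · exact (mul_le_mul (hBn 1) (hBν 0) (abs_nonneg _) zero_le_one).trans (one_mul _).le
  -- conclude
  rw [hdetT, habsA, ENNReal.ofReal_mul (abs_nonneg _)]
  exact mul_le_mul_of_nonneg_right (ENNReal.ofReal_le_ofReal hHle) bot_le


/-- **Coarea-shadow inequality, global form**: `vol₄ ((x ↦ (⟪B (inl k), ι x⟫)ₖ) '' S) ≤ ∫⁻_S 2‖truncL (ν x)‖ d(ι^* μHE⁴)`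
for every measurable `S ⊆ M` (finite chart cover of the compact `M`, induction on the cover, and
`volume_image_coords_le_chart` on each piece). [cite: Federer1969, 3.2.3] -/
theorem volume_image_coords_le {ι ν : M → (EuclideanSpace ℝ (Fin 6))}
    (hι : Manifold.IsSmoothEmbedding (𝓡 4) (𝓡 6) ∞ ι)
    (hιN : ∀ x, ∑ i : Fin 5, ι x (Fin.castSucc i) ^ 2 = 1)
    (hνc : Continuous ν) (hνn : (euclideanMetric (EuclideanSpace ℝ (Fin 6))).IsUnitNormal (𝓡 4) ι ν 1)
    (hνt : ∀ x, ∑ i : Fin 5, ν x (Fin.castSucc i) * ι x (Fin.castSucc i) = 0)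
    (B : OrthonormalBasis (Fin 4 ⊕ Fin 2) ℝ (EuclideanSpace ℝ (Fin 6))) (hB : ∀ a : Fin 2, B (Sum.inr a) 5 = 0)
    {S : Set M} (hS : MeasurableSet S) :
    volume ((fun x : M => (EuclideanSpace.equiv (Fin 4) ℝ).symm fun k => ⟪B (Sum.inl k), ι x⟫) '' S) ≤
      ∫⁻ x in S, ENNReal.ofReal (2 * ‖truncL (ν x)‖)
        ∂(Measure.comap ι (μHE[4] : Measure (EuclideanSpace ℝ (Fin 6)))) := by
  classical
  obtain ⟨t, ht⟩ := isCompact_univ.elim_finite_subcover (fun x : M => (extChartAt (𝓡 4) x).source)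
    (fun x => isOpen_extChartAt_source (I := 𝓡 4) x) (fun x _ => mem_iUnion.2 ⟨x, mem_extChartAt_source x⟩)
  set Ψ := (fun x : M => (EuclideanSpace.equiv (Fin 4) ℝ).symm fun k => ⟪B (Sum.inl k), ι x⟫) with hΨ
  set g : M → ℝ≥0∞ := fun x => ENNReal.ofReal (2 * ‖truncL (ν x)‖) with hg
  suffices h : ∀ (s : Finset M) (S : Set M), MeasurableSet S → (S ⊆ ⋃ x ∈ s, (extChartAt (𝓡 4) x).source) →
      volume (Ψ '' S) ≤ ∫⁻ x in S, g x ∂(Measure.comap ι (μHE[4] : Measure (EuclideanSpace ℝ (Fin 6)))) from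
    h t S hS fun x hx => ht (mem_univ x)
  intro s
  induction s using Finset.induction_on with
  | empty =>
    intro S _ hS0
    have hSe : S = ∅ := subset_empty_iff.1 (by simpa using hS0)
    rw [hSe, image_empty, measure_empty]
    exact bot_le
  | insert a s _ ih =>
    intro S hSm hSsub
    have hsrc : MeasurableSet (extChartAt (𝓡 4) a).source := (isOpen_extChartAt_source (I := 𝓡 4) a).measurableSet
    have h1 := volume_image_coords_le_chart hι hιN hνc hνn hνt B hB a (hSm.inter hsrc) inter_subset_right
    have h2 : S \ (extChartAt (𝓡 4) a).source ⊆ ⋃ x ∈ s, (extChartAt (𝓡 4) x).source := by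
      intro x hx
      obtain ⟨i, hi, hxi⟩ := mem_iUnion₂.1 (hSsub hx.1)
      rcases Finset.mem_insert.1 hi with rfl | hi'
      · exact absurd hxi hx.2
      · exact mem_iUnion₂.2 ⟨i, hi', hxi⟩
    have h3 := ih (S \ (extChartAt (𝓡 4) a).source) (hSm.diff hsrc) h2
    calc volume (Ψ '' S)
        = volume (Ψ '' (S ∩ (extChartAt (𝓡 4) a).source) ∪ Ψ '' (S \ (extChartAt (𝓡 4) a).source)) := by
          rw [← image_union, inter_union_sdiff]
      _ ≤ volume (Ψ '' (S ∩ (extChartAt (𝓡 4) a).source)) + volume (Ψ '' (S \ (extChartAt (𝓡 4) a).source)) :=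
          measure_union_le _ _
      _ ≤ _ := add_le_add h1 h3
      _ = ∫⁻ x in S, g x ∂(Measure.comap ι (μHE[4] : Measure (EuclideanSpace ℝ (Fin 6)))) :=
          lintegral_inter_add_sdiff _ _ hsrc

/-- **Coarea-shadow inequality, sliced by height.** With the last kept coordinate read as the level `c` and the first
three as `v ∈ ℝ³`: for a closed `S ⊆ M`,
`∫⁻ c, vol₃ {v | (c, v) ∈ Ψ' '' S} dc ≤ ∫⁻_S 2‖truncL (ν x)‖ d(ι^* μHE⁴)`, `Ψ' x = (⟪B (inl 3), ι x⟫, (⟪B (inl k), ι x⟫)_{k<3})`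
(Tonelli for the compact, hence measurable, image, and the volume-preserving reindexing `ℝ⁴ ≃ ℝ × ℝ³`). This is the
form consumed by the telescoping-over-levels inequality (`CubeTelescoping.mul_volume_mul_volume_le_lintegral_levels`).
[cite: Federer1969, 3.2.3] -/
theorem lintegral_volume_slice_image_coords_le {ι ν : M → (EuclideanSpace ℝ (Fin 6))}
    (hι : Manifold.IsSmoothEmbedding (𝓡 4) (𝓡 6) ∞ ι)
    (hιN : ∀ x, ∑ i : Fin 5, ι x (Fin.castSucc i) ^ 2 = 1)
    (hνc : Continuous ν) (hνn : (euclideanMetric (EuclideanSpace ℝ (Fin 6))).IsUnitNormal (𝓡 4) ι ν 1)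
    (hνt : ∀ x, ∑ i : Fin 5, ν x (Fin.castSucc i) * ι x (Fin.castSucc i) = 0)
    (B : OrthonormalBasis (Fin 4 ⊕ Fin 2) ℝ (EuclideanSpace ℝ (Fin 6))) (hB : ∀ a : Fin 2, B (Sum.inr a) 5 = 0)
    {S : Set M} (hS : IsClosed S) :
    ∫⁻ c : ℝ, volume {v : Fin 3 → ℝ | (c, v) ∈ (fun x : M =>
        (⟪B (Sum.inl (Fin.last 3)), ι x⟫, (fun m : Fin 3 => ⟪B (Sum.inl (Fin.castSucc m)), ι x⟫))) '' S} ≤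
      ∫⁻ x in S, ENNReal.ofReal (2 * ‖truncL (ν x)‖)
        ∂(Measure.comap ι (μHE[4] : Measure (EuclideanSpace ℝ (Fin 6)))) := by
  classical
  set Ψ := (fun x : M => (EuclideanSpace.equiv (Fin 4) ℝ).symm fun k => ⟪B (Sum.inl k), ι x⟫) with hΨ
  set Ψ' := (fun x : M => (⟪B (Sum.inl (Fin.last 3)), ι x⟫,
    (fun m : Fin 3 => ⟪B (Sum.inl (Fin.castSucc m)), ι x⟫))) with hΨ'
  have hιc : Continuous ι := hι.contMDiff.continuous
  -- the volume-preserving reindexing `e : ℝ⁴ ≃ ℝ × ℝ³` with `e ∘ Ψ = Ψ'`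
  set e : EuclideanSpace ℝ (Fin 4) ≃ᵐ ℝ × (Fin 3 → ℝ) :=
    (MeasurableEquiv.toLp 2 (Fin 4 → ℝ)).symm.trans
      (MeasurableEquiv.piFinSuccAbove (fun _ : Fin 4 => ℝ) (Fin.last 3)) with hedef
  have he : MeasurePreserving e volume volume :=
    (volume_preserving_piFinSuccAbove (fun _ : Fin 4 => ℝ) (Fin.last 3)).comp
      (EuclideanSpace.volume_preserving_symm_measurableEquiv_toLp (Fin 4))
  have heΨ : ∀ x, e (Ψ x) = Ψ' x := fun x => by
    simp only [hedef, hΨ, hΨ', MeasurableEquiv.trans_apply, MeasurableEquiv.piFinSuccAbove_apply,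
      MeasurableEquiv.coe_toLp_symm, Fin.insertNthEquiv_symm_apply]
    refine Prod.ext rfl (funext fun m => ?_)
    simp only [Fin.removeNth, Fin.succAbove_last]
    rfl
  have himg : Ψ' '' S = e '' (Ψ '' S) := by
    rw [image_image]
    exact image_congr fun x _ => (heΨ x).symm
  -- the image is compact, hence measurable
  have hΨ'c : Continuous Ψ' := by
    refine Continuous.prodMk ?_ (continuous_pi fun m => ?_)
    · exact continuous_const.inner hιc
    · exact continuous_const.inner hιc
  have hXm : MeasurableSet (Ψ' '' S) := ((hS.isCompact).image hΨ'c).isClosed.measurableSet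
  -- Tonelli
  have htonelli : ∫⁻ c : ℝ, volume {v : Fin 3 → ℝ | (c, v) ∈ Ψ' '' S} = volume (Ψ' '' S) := by
    rw [show (volume : Measure (ℝ × (Fin 3 → ℝ))) = (volume : Measure ℝ).prod volume from rfl,
      Measure.prod_apply hXm]
    rfl
  rw [htonelli, himg, MeasurableEquiv.image_eq_preimage_symm, (he.symm e).measure_preimage_equiv]
  exact volume_image_coords_le hι hιN hνc hνn hνt B hB hS.measurableSet

end Summit.SmoothPoincare4.SmoothPoincare4.Theorems.CylinderRungTwo.KillingFlux

end
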